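import Mathlib
import HarnessLib
import Literature.MathematicalPhysics.QuantumFieldTheory.ConstructiveQFTWave0
import Summits.Ventures.LatticeQCDFlow.Scaling.LatticeEntropy
import Summits.Ventures.LatticeQCDFlow.Scaling.LatticePeeling
import Summits.Ventures.LatticeQCDFlow.Scaling.LatticeGibbs

/-!
# LatticeQCDFlow / Scaling — CRUDE ENTROPY GROWTH of the Wilson measure, PROVED
(THEORY-2.md §3.2 v2.0 (b)–(d) / §4 T2-AH(d), no gauge fixing; R-T2-10)

HONEST FRAMING: exact (Metropolis-corrected) sampling algorithms for lattice gauge theory;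
figures of merit are autocorrelation/cost numbers at stated couplings and volumes; no
continuum-physics claim.

`theorem crudeEntropyGrowth (d : ℕ) (κ : ℝ) : CrudeEntropyGrowth d κ` — for the Wilson theory of
ANY continuous `ρ` (`Re tr ρ ≤ N`) of ANY compact second-countable `G` on `(ℤ/L)^d`, under the two
ONE-PLAQUETTE hypotheses of `EntropyGrowth` — (H1) `Z₁(β) ≤ A·β^{−κ/2}` and (H2) small balls
`B_ε` of Haar mass `≥ a·ε^κ` with four-fold plaquette action `≤ b·ε²` (read `κ = dim G`; both are
routine for `U(1)`, `SU(N)`) — and `κ ≥ 0`: there is `C` with, for all `L ≥ 2`, `β ≥ 1`, `V = L^d`,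

  `κ·V·((d−2)/2 − (d−1)/L)·log β − C·V ≤ D(μ_{Λ,β} ‖ Haar^{⊗E}) ≤ κ·(d·V/2)·log β + C·V`.

So the relative entropy of the lattice Yang–Mills measure w.r.t. the product-Haar prior — the
budget `log M + E log J ≥ D − log(1/ESS)` that every exact flow from that prior must supply
(`Scaling/EntropyBudget.lean`) — is EXTENSIVE and grows like `V·log β` (lower coefficient positive
for `d ≥ 3`, `L > 2(d−1)/(d−2)`; `d = 4`: `L ≥ 4`).  ASSEMBLY of four theorems of this package:
`smallBallBound` (#13, at `β`, `ε = β^{−1/2}`), `peelingBound` (#14, at `β/2`), `gibbsIdentity` and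
`twoFreeEnergies_wilson` (#15, `β₁ = β/2`), plus cardinality bookkeeping (`#E = dV`, `#P ≤ d²V`,
`m = (d−1)L^{d−1}(L−1) ≤ dV`, `m − dV/2 ≥ V((d−2)/2 − (d−1)/L)`).  The sharp coefficients of
`EntropyGrowth` (`κ((d−1)V(1/2−1/L) − 1/2)` below, `κ((d−1)V+1)/2` above) need only the tree gauge
(`TreeGaugeSmallBallBound`) in place of `smallBallBound`.  Axioms: propext, Classical.choice,
Quot.sound.
-/

namespace Summit.Ventures.LatticeQCDFlow.Theory2.Lattice

open MeasureTheory Literature.MathematicalPhysics.QuantumFieldTheory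

/-! ## Crude entropy growth (T2-AH(d) WITHOUT gauge fixing): the two-sided `V·log β` law,
assembled from `smallBallBound`, `peelingBound`, `gibbsIdentity`, `twoFreeEnergies_wilson` -/

section Growth

variable {N : ℕ} {G : Type} [Group G] [TopologicalSpace G] [IsTopologicalGroup G]
  [CompactSpace G] [SecondCountableTopology G] [MeasurableSpace G] [BorelSpace G]
  (ρ : G →* Matrix (Fin N) (Fin N) ℂ)

omit [SecondCountableTopology G] in
/-- `0 < Z₁(β)` for `β ≥ 0` (positive integrand against the Haar probability measure; finite
because the integrand is `≤ 1`). [folklore] -/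
theorem onePlaquetteZ_pos (hρ : Continuous (ρ : G → Matrix (Fin N) (Fin N) ℂ))
    (htr : ∀ g, (ρ g).trace.re ≤ N) (β : ℝ) (hβ : 0 ≤ β) : 0 < onePlaquetteZ ρ β := by
  unfold onePlaquetteZ
  have hmeas : Measurable fun g : G =>
      ENNReal.ofReal (Real.exp (-(β * ((N : ℝ) - (ρ g).trace.re)))) := by
    have h2 : Continuous fun g : G => (ρ g).trace.re := Complex.continuous_re.comp hρ.matrix_trace
    have h0 : Continuous fun t : ℝ => Real.exp (-(β * ((N : ℝ) - t))) := by fun_prop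
    exact (h0.comp h2).measurable.ennreal_ofReal
  refine ENNReal.toReal_pos (ne_of_gt ((lintegral_pos_iff_support hmeas).mpr ?_)) ?_
  · have hsupp : Function.support (fun g : G =>
        ENNReal.ofReal (Real.exp (-(β * ((N : ℝ) - (ρ g).trace.re))))) = Set.univ := by
      ext g
      simp only [Function.mem_support, ne_eq, ENNReal.ofReal_eq_zero, not_le, Set.mem_univ,
        iff_true]
      exact Real.exp_pos _
    rw [hsupp, measure_univ]
    exact one_pos
  · refine ne_top_of_le_ne_top ENNReal.one_ne_top ?_
    calc ∫⁻ g, ENNReal.ofReal (Real.exp (-(β * ((N : ℝ) - (ρ g).trace.re)))) ∂haarProbability G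
        ≤ ∫⁻ _, 1 ∂haarProbability G := lintegral_mono fun g => ?_
      _ = 1 := by rw [lintegral_const, measure_univ, mul_one]
    rw [ENNReal.ofReal_le_one]
    apply Real.exp_le_one_iff.mpr
    have := htr g
    nlinarith

/-- **(T2-AH(d), crude form — typed item, PROVED below.)**  CRUDE ENTROPY GROWTH (no gauge
fixing): under the one-plaquette decay hypothesis (H1) `Z₁(β) ≤ A·β^{−κ/2}` and the small-ball
hypothesis (H2) (balls `B_ε` of Haar mass `≥ a·ε^κ` on which every product of four elements of
`B_ε ∪ B_ε⁻¹ ∪ {1}` has plaquette action `≤ b·ε²`), with `κ ≥ 0` (read `κ = dim G`), for all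
`L ≥ 2`, `β ≥ 1`, `V = L^d`:
`κ·V·((d−2)/2 − (d−1)/L)·log β − C·V ≤ D(μ_{Λ,β} ‖ Haar^{⊗E}) ≤ κ·(dV/2)·log β + C·V`.
The lower coefficient is positive for `d ≥ 3`, `L > 2(d−1)/(d−2)` (e.g. `d = 4`, `L ≥ 4`): the
relative entropy of the Wilson measure w.r.t. the product Haar prior — the quantity every exact
flow from the Haar prior must supply as `log M + E log J` (package `Scaling/EntropyBudget.lean`) —
grows like `V·log β`.  The sharp coefficients `κ((d−1)V(1/2 − 1/L) − 1/2)` (lower) and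
`κ((d−1)V + 1)/2` (upper) of `EntropyGrowth` need the tree gauge (`TreeGaugeSmallBallBound`).
[folklore] -/
@[conjecture]
def CrudeEntropyGrowth (d : ℕ) (κ : ℝ) : Prop :=
  ∀ (N : ℕ) (G : Type) [Group G] [TopologicalSpace G] [IsTopologicalGroup G] [CompactSpace G]
    [SecondCountableTopology G] [MeasurableSpace G] [BorelSpace G]
    (ρ : G →* Matrix (Fin N) (Fin N) ℂ),
    Continuous (ρ : G → Matrix (Fin N) (Fin N) ℂ) → (∀ g, (ρ g).trace.re ≤ N) → 0 ≤ κ →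
    (∃ A : ℝ, ∀ β : ℝ, 0 < β → onePlaquetteZ ρ β ≤ A * β ^ (-(κ / 2))) →
    (∃ a b : ℝ, 0 < a ∧ ∀ ε : ℝ, 0 < ε → ε ≤ 1 → ∃ B : Set G, MeasurableSet B ∧
        a * ε ^ κ ≤ (haarProbability G B).toReal ∧
        ∀ g₁ ∈ insert (1 : G) (B ∪ B⁻¹), ∀ g₂ ∈ insert (1 : G) (B ∪ B⁻¹),
          ∀ g₃ ∈ insert (1 : G) (B ∪ B⁻¹), ∀ g₄ ∈ insert (1 : G) (B ∪ B⁻¹),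
            (N : ℝ) - (ρ (g₁ * g₂ * g₃ * g₄)).trace.re ≤ b * ε ^ 2) →
    ∃ C : ℝ, ∀ (L : ℕ) [NeZero L], 2 ≤ L → ∀ β : ℝ, 1 ≤ β →
      κ * (L : ℝ) ^ d * (((d : ℝ) - 2) / 2 - ((d : ℝ) - 1) / L) * Real.log β - C * (L : ℝ) ^ d ≤
          (InformationTheory.klDiv (wilsonMeasure (d := d) (L := L) ρ β)
              (Measure.pi fun _ : Edge d L => haarProbability G)).toReal ∧
        (InformationTheory.klDiv (wilsonMeasure (d := d) (L := L) ρ β)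
              (Measure.pi fun _ : Edge d L => haarProbability G)).toReal ≤
          κ * ((d : ℝ) * (L : ℝ) ^ d / 2) * Real.log β + C * (L : ℝ) ^ d

/-- **T2-AH(d) CRUDE ENTROPY GROWTH, PROVED.** [folklore] -/
theorem crudeEntropyGrowth (d : ℕ) (κ : ℝ) : CrudeEntropyGrowth d κ := by
  intro N G _ _ _ _ _ _ _ ρ hρ htr hκ hH1 hH2
  obtain ⟨A, hA⟩ := hH1
  obtain ⟨a, b, ha, hab⟩ := hH2
  have hApos : 0 < A := by
    have h := hA 1 one_pos
    rw [Real.one_rpow, mul_one] at h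
    exact lt_of_lt_of_le (onePlaquetteZ_pos ρ hρ htr 1 zero_le_one) h
  have hb : 0 ≤ b := by
    obtain ⟨B, -, -, hB⟩ := hab 1 one_pos le_rfl
    have h := hB 1 (Set.mem_insert _ _) 1 (Set.mem_insert _ _) 1 (Set.mem_insert _ _)
      1 (Set.mem_insert _ _)
    simpa using h
  have hlog2 : 0 < Real.log 2 := Real.log_pos one_lt_two
  refine ⟨(d : ℝ) * |Real.log a| + b * (d : ℝ) ^ 2 + 2 * (d : ℝ) * |Real.log A| +
    (d : ℝ) * κ * Real.log 2, fun L _ hL β hβ => ?_⟩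
  have hβ0 : 0 < β := by linarith
  have hL1 : (1 : ℝ) ≤ L := by exact_mod_cast (by omega : 1 ≤ L)
  have hL0 : (0 : ℝ) < L := by linarith
  have hLd : (0 : ℝ) < (L : ℝ) ^ d := by positivity
  have hlogβ : 0 ≤ Real.log β := Real.log_nonneg hβ
  -- the ball at scale `ε = β^{-1/2}`
  set ε : ℝ := β ^ (-(1 / 2 : ℝ)) with hε
  have hε0 : 0 < ε := Real.rpow_pos_of_pos hβ0 _
  have hε1 : ε ≤ 1 := Real.rpow_le_one_of_one_le_of_nonpos hβ (by norm_num)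
  obtain ⟨B, hBm, hBa, hBs⟩ := hab ε hε0 hε1
  have hε2 : β * (b * ε ^ 2) = b := by
    have h2 : ε ^ 2 = β⁻¹ := by
      rw [hε, ← Real.rpow_natCast (β ^ (-(1 / 2 : ℝ))) 2, ← Real.rpow_mul hβ0.le]
      norm_num [Real.rpow_neg_one]
    rw [h2]
    field_simp
  have haε : 0 < a * ε ^ κ := mul_pos ha (Real.rpow_pos_of_pos hε0 κ)
  have hHpos : 0 < (haarProbability G B).toReal := lt_of_lt_of_le haε hBa
  have f5 : Real.log a - κ / 2 * Real.log β ≤ Real.log (haarProbability G B).toReal := by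
    have h := Real.log_le_log haε hBa
    rw [Real.log_mul ha.ne' (Real.rpow_pos_of_pos hε0 κ).ne', Real.log_rpow hε0, hε,
      Real.log_rpow hβ0] at h
    linarith
  -- cardinalities
  have hE : (Fintype.card (Edge d L) : ℝ) = d * (L : ℝ) ^ d := by
    rw [show Fintype.card (Edge d L) = L ^ d * d by
      simp [Fintype.card_prod, ZMod.card, Fintype.card_fin]]
    push_cast
    ring
  have hP : (Fintype.card (Plaquette d L) : ℝ) ≤ (d : ℝ) ^ 2 * (L : ℝ) ^ d := by
    have h1 : Fintype.card (Plaquette d L) =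
        L ^ d * Fintype.card {p : Fin d × Fin d // p.1 < p.2} := by
      simp [Fintype.card_prod, ZMod.card, Fintype.card_fin]
    have h2 : Fintype.card {p : Fin d × Fin d // p.1 < p.2} ≤ d * d :=
      (Fintype.card_subtype_le _).trans (by simp)
    have h3 : (Fintype.card (Plaquette d L) : ℝ) ≤ (L : ℝ) ^ d * (d * d : ℝ) := by
      rw [h1]; push_cast; gcongr; exact_mod_cast h2
    nlinarith [h3]
  -- the peeling exponent `m`
  set m : ℕ := (d - 1) * L ^ (d - 1) * (L - 1) with hm
  have hm_le : (m : ℝ) ≤ d * (L : ℝ) ^ d := by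
    have h : m ≤ d * L ^ d := by
      rcases Nat.eq_zero_or_pos d with hd | hd
      · simp [hm, hd]
      · obtain ⟨n, rfl⟩ : ∃ n, d = n + 1 := ⟨d - 1, by omega⟩
        simp only [hm, Nat.add_sub_cancel]
        calc n * L ^ n * (L - 1) ≤ (n + 1) * L ^ n * L := by
              gcongr <;> omega
          _ = (n + 1) * L ^ (n + 1) := by ring
    exact_mod_cast h
  have hm0 : (0 : ℝ) ≤ m := Nat.cast_nonneg _
  have hcoef : (L : ℝ) ^ d * (((d : ℝ) - 2) / 2 - ((d : ℝ) - 1) / L) ≤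
      (m : ℝ) - d * (L : ℝ) ^ d / 2 := by
    rcases Nat.eq_zero_or_pos d with hd | hd
    · subst hd
      have hm_zero : (m : ℝ) = 0 := by simp [hm]
      have hinv : (L : ℝ)⁻¹ ≤ 1 := inv_le_one_of_one_le₀ hL1
      rw [hm_zero, pow_zero, Nat.cast_zero]
      have e : (1 : ℝ) * (((0 : ℝ) - 2) / 2 - ((0 : ℝ) - 1) / (L : ℝ)) = -1 + (L : ℝ)⁻¹ := by ring
      rw [e]
      linarith
    · obtain ⟨n, rfl⟩ : ∃ n, d = n + 1 := ⟨d - 1, by omega⟩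
      have hcast : (m : ℝ) = n * (L : ℝ) ^ n * ((L : ℝ) - 1) := by
        simp only [hm, Nat.add_sub_cancel]
        push_cast [Nat.cast_sub (by omega : 1 ≤ L)]
        ring
      rw [hcast]
      apply le_of_eq
      push_cast
      field_simp
      ring
  -- the four proved ingredients
  have hZpos : 0 < (partitionFunction (d := d) (L := L) ρ β).toReal :=
    ENNReal.toReal_pos (partitionFunction_ne_zero ρ hρ β)
      (ne_top_of_le_ne_top ENNReal.one_ne_top (partitionFunction_le_one ρ htr hβ0.le))
  have hZhpos : 0 < (partitionFunction (d := d) (L := L) ρ (β / 2)).toReal :=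
    ENNReal.toReal_pos (partitionFunction_ne_zero ρ hρ (β / 2))
      (ne_top_of_le_ne_top ENNReal.one_ne_top (partitionFunction_le_one ρ htr (by positivity)))
  -- (1) small balls at `β`
  have f1 : d * (L : ℝ) ^ d * Real.log (haarProbability G B).toReal -
      b * Fintype.card (Plaquette d L) ≤
        Real.log (partitionFunction (d := d) (L := L) ρ β).toReal := by
    have hSB := smallBallBound d N G ρ hρ htr L β hβ0.le B hBm (b * ε ^ 2) hBs
    rw [hε2] at hSB
    have hpos : 0 < (haarProbability G B).toReal ^ Fintype.card (Edge d L) *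
        Real.exp (-(b * Fintype.card (Plaquette d L))) := by positivity
    have h := Real.log_le_log hpos hSB
    rw [Real.log_mul (pow_pos hHpos _).ne' (Real.exp_pos _).ne', Real.log_pow, Real.log_exp,
      hE] at h
    linarith
  -- (2) two free energies at `β₁ = β/2`
  have f2 : Real.log (partitionFunction (d := d) (L := L) ρ β).toReal -
      2 * Real.log (partitionFunction (d := d) (L := L) ρ (β / 2)).toReal ≤
        (InformationTheory.klDiv (wilsonMeasure (d := d) (L := L) ρ β)
          (Measure.pi fun _ : Edge d L => haarProbability G)).toReal := by
    have h := twoFreeEnergies_wilson (d := d) (L := L) ρ hρ htr β (β / 2) hβ0.le (by positivity)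
    have h2 : (0 : ℝ) < β / 2 := by positivity
    rw [show β - β / 2 = β / 2 by ring] at h
    refine le_of_mul_le_mul_left ?_ h2
    linarith
  -- (3) peeling at `β/2`
  have f3 : Real.log (partitionFunction (d := d) (L := L) ρ (β / 2)).toReal ≤
      m * Real.log (onePlaquetteZ ρ (β / 2)) := by
    have h := Real.log_le_log hZhpos (peelingBound d N G ρ hρ htr L hL (β / 2) (by positivity))
    rwa [Real.log_pow] at h
  -- (4) one-plaquette decay at `β/2`
  have f4 : Real.log (onePlaquetteZ ρ (β / 2)) ≤
      Real.log A - κ / 2 * (Real.log β - Real.log 2) := by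
    have hβ2 : 0 < β / 2 := by positivity
    have h := Real.log_le_log (onePlaquetteZ_pos ρ hρ htr (β / 2) hβ2.le) (hA (β / 2) hβ2)
    rw [Real.log_mul hApos.ne' (Real.rpow_pos_of_pos hβ2 _).ne', Real.log_rpow hβ2,
      Real.log_div hβ0.ne' two_ne_zero] at h
    linarith
  -- (5) Gibbs: `D ≤ −log Z`
  have f6 : (InformationTheory.klDiv (wilsonMeasure (d := d) (L := L) ρ β)
        (Measure.pi fun _ : Edge d L => haarProbability G)).toReal ≤
      -Real.log (partitionFunction (d := d) (L := L) ρ β).toReal := by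
    have hG := gibbsIdentity d N G ρ hρ htr L β hβ0.le
    have hES : 0 ≤ wilsonExpectation (d := d) (L := L) ρ β (wilsonAction (d := d) (L := L) ρ) := by
      unfold wilsonExpectation
      exact integral_nonneg fun U => wilsonAction_nonneg ρ htr U
    have := mul_nonneg hβ0.le hES
    linarith
  -- products for the linear arithmetic
  have g34 : (m : ℝ) * Real.log (onePlaquetteZ ρ (β / 2)) ≤
      m * (Real.log A - κ / 2 * (Real.log β - Real.log 2)) := mul_le_mul_of_nonneg_left f4 hm0
  have g5 : d * (L : ℝ) ^ d * (Real.log a - κ / 2 * Real.log β) ≤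
      d * (L : ℝ) ^ d * Real.log (haarProbability G B).toReal :=
    mul_le_mul_of_nonneg_left f5 (by positivity)
  have gco : κ * Real.log β * ((L : ℝ) ^ d * (((d : ℝ) - 2) / 2 - ((d : ℝ) - 1) / L)) ≤
      κ * Real.log β * ((m : ℝ) - d * (L : ℝ) ^ d / 2) :=
    mul_le_mul_of_nonneg_left hcoef (mul_nonneg hκ hlogβ)
  have gP : b * (Fintype.card (Plaquette d L) : ℝ) ≤ b * ((d : ℝ) ^ 2 * (L : ℝ) ^ d) :=
    mul_le_mul_of_nonneg_left hP hb
  have gm1 : (m : ℝ) * |Real.log A| ≤ d * (L : ℝ) ^ d * |Real.log A| :=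
    mul_le_mul_of_nonneg_right hm_le (abs_nonneg _)
  have gm2 : (m : ℝ) * Real.log A ≤ m * |Real.log A| :=
    mul_le_mul_of_nonneg_left (le_abs_self _) hm0
  have gm3 : (m : ℝ) * (κ * Real.log 2) ≤ d * (L : ℝ) ^ d * (κ * Real.log 2) :=
    mul_le_mul_of_nonneg_right hm_le (mul_nonneg hκ hlog2.le)
  have ga1 : d * (L : ℝ) ^ d * (-|Real.log a|) ≤ d * (L : ℝ) ^ d * Real.log a :=
    mul_le_mul_of_nonneg_left (neg_abs_le _) (by positivity)
  have ga2 : d * (L : ℝ) ^ d * Real.log a ≤ d * (L : ℝ) ^ d * |Real.log a| :=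
    mul_le_mul_of_nonneg_left (le_abs_self _) (by positivity)
  have gn1 : 0 ≤ d * (L : ℝ) ^ d * |Real.log A| := by positivity
  have gn2 : 0 ≤ d * (L : ℝ) ^ d * (κ * Real.log 2) := by positivity
  constructor
  · linarith
  · linarith

end Growth

end Summit.Ventures.LatticeQCDFlow.Theory2.Lattice
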